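import Summits.Schanuel.Schanuel.Theses.TateNomes
import Summits.Schanuel.Schanuel.Theorems.TateLocusGPCOne.Negative.TateLocusGPCOneLoadBearing
import Summits.Schanuel.Schanuel.Theorems.TateLocusGPCOne.Negative.TateLocusGPCOneCalibration
import Summits.Schanuel.Schanuel.Theorems.TateLocusGPCOne.Negative.TateLocusGPCOneGenerators
import Summits.Schanuel.Schanuel.Theorems.TateLocusGPCOne.Negative.TateLocusGPCOneAlgebraicNome
import Literature.Barriers.Schanuel.NesterenkoModularScopeConjectureProofs

/-!
# Disproof of `TateLocusGPCOne` (crux `stmt-Schanuel-17406`, route `TateNomes`) — standing adversary file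

Crux (decl `Summit.Schanuel.Schanuel.Theses.TateNomes.TateLocusGPCOne`, SUPPORT item, rank 9, not a
binder of the route's `closes`; the two provable binders `NomeHygiene`, `NomeTransfer` are PROVED,
the third binder `TateLocusGPC` is the several-nome version of this crux):

  `∀ τ : ℂ, 0 < Im τ → (∀ b c : ℚ, τ² + bτ + c ≠ 0) → 5 ≤ trdeg_ℚ ℚ(2πi, τ, q, P(q), Q(q), R(q))`,
  `q = e^{2πiτ}`, `P, Q, R` = Ramanujan's `q`-series (`= E₂, E₄, E₆(τ)`; `rfl`-equal to
  `Literature.Barriers.Schanuel.ramanujanP/Q/R`).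

## Findings — cycle 1 (everything below is sorry-free, standard axioms; the theorems live in
## `Theorems/TateLocusGPCOne/Negative/{TateLocusGPCOneLoadBearing (p143528, earlier seat),
## TateLocusGPCOneCalibration, TateLocusGPCOneGenerators, TateLocusGPCOneAlgebraicNome}.lean`
## and are re-exported here by name)

* §0 IDENTITY OF THE STATEMENT (why no cheap kill exists). With the lattice `ℤ + τℤ`
  (`ω₁ = 1, ω₂ = τ`): `g₂ = (2πi)⁴Q/12`, `g₃ = −(2πi)⁶R/216`, `η₁ = −(2πi)²P/12`, Legendre
  `τη₁ − η₂ = 2πi`, `log q = 2πiτ`; hence LITERALLY (not only up to algebraic closure)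
  `ℚ(2πi, τ, q, P, Q, R) = ℚ(g₂, g₃, q)(ω₁, ω₂, η₁, η₂, 2πi, log q)` = the field generated over the
  field of definition `K = ℚ(g₂, g₃, q)` by the periods of the 1-motive `M_τ = h¹(E_τ) ⊕ [ℤ → 𝔾_m; 1 ↦ q]`.
  Under the hypotheses `E_τ` is non-CM (`τ` non-quadratic) and `q` is not a root of unity
  (`|q| < 1`), so `G_mot(M_τ) = 𝔾_a ⋊ GL₂`, `dim = 5` EXACTLY (unipotent radical `= Hom(ℚ(0), ℚ(1))`,
  non-zero iff `q` non-torsion). So the crux is, point by point, André's generalized period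
  conjecture `trdeg_ℚ K(P(M)) ≥ dim G_mot(M)` for `M_τ` (= Bertolin–Waldschmidt arXiv:2504.14048
  Conj. 2.1 at `(s,n) = (1,2)`; = Nesterenko's Conj. 1.11 (corrected) + `2πi`). A refutation of the
  crux is a counterexample to André's GPC. Nothing weaker is claimed anywhere on the domain: the
  bound `5` equals `dim G_mot` at EVERY admissible `τ` (no slack to attack).
* §1 LOAD-BEARING HYPOTHESES (each dropped hypothesis ⇒ FALSE, kernel-checked witness):
  - `τ` non-quadratic (non-CM): `crux_false_without_nonQuadratic` (p143528; `τ = i`, `R = E₆(i) = 0`).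
    SHARPENED this cycle: `crux_cm_calibration : trdeg ℚ(2πi, i, e^{−2π}, P, Q, R) = 3` EXACTLY
    (upper: `P = E₂(i) = 3/π = 6i/2πi`, `R = 0`, `i ∈ ℚ̄`; lower: Nesterenko's theorem, tree
    `nesterenko1996_thm_1_1_holds`) and `not_crux_four_without_nonQuadratic`: without non-CM even
    `4 ≤ trdeg` fails. The CM exclusion is worth TWO degrees (`dim GL₂ − dim T = 2`), exactly the
    two (`τ` and `π`) the non-CM statement asks for beyond Nesterenko's `3`.
  - `0 < Im τ`: `crux_false_without_imPos` (`τ₁ = −i·2^{1/4}`: `|q| ≥ 1`, the `q`-series diverge,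
    `tsum = 0` junk, `P = Q = R = 1`, `trdeg ≤ 2`). It is the convergence hypothesis; on `∂ℍ` and
    below the statement is not even meaningful.
  - the generator list: `crux_false_without_gen_twoPiI/_q/_P/_Q/_R` (at `τ₀ = i·2^{1/4}`, five
    generators one algebraic ⇒ `≤ 4`) and `crux_false_without_gen_tau` (at the ALGEBRAIC NOME
    `q = (3+4i)/10`): every one of the six numbers carries a full degree somewhere on the domain;
    in particular "5 for `ℚ(τ, q, P, Q, R)`" is false (the right claim there is Conj. 1.11's `4`).
* §2 NON-VACUITY / CERTIFIED TEST POINTS of the three special fibres (hypotheses verified in Lean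
  with NO transcendence input): `τ₀ = i·2^{1/4}` (fibre `τ ∈ ℚ̄`, degree 4; p143528),
  `τ_α = log((3+4i)/10)/2πi` (fibre `q ∈ ℚ̄`: `Im τ_α = log 2/2π`, non-quadratic because a non-real
  quadratic has RATIONAL real part while `Re τ_α ∈ ℚ` would make some `(3+4i)ⁿ` real, and
  `(3+4i)ⁿ ≡ 3+4i (mod 5)` — `crux_hypotheses_at_algebraic_nome`), and the CM point `τ = i`
  (excluded, value `3`). The `(e, π)` fibre `τ = i/2π` needs `π² ∉ ℚ` for non-quadraticity (not in
  Mathlib; grounder g79-3 flagged it for `EPiOfTateOne`).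
* §3 TIGHTNESS: `not_crux_six` (p143528: `6 ≤ trdeg` false at `τ₀`), `crux_trdeg_le_five_at_algebraic_nome`
  (`≤ 5` at `τ_α`): on both the algebraic-`τ` and the algebraic-nome fibre the claimed `5` is the
  maximum possible, so the crux predicts EXACT values there (`= 5`), i.e. full algebraic
  independence of `π, q, P, Q, R` (resp. `2πi, log α, P(α), Q(α), R(α)`).
* §4 NATURAL STRENGTHENINGS: `6 ≤` refuted (§3); "without `2πi`, still `5`" refuted (§1); the
  additive split `NesterenkoTau ∧ PiRigidity` of the strategist (StrategistSketch.lean) is an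
  EQUIVALENT reformulation (glue both ways proved there), not a strengthening — both halves are GPC
  consequences, neither is attackable by a finite computation. The line's stub `TwoNomeS`
  (PICKED.md, card s-dual-second-cusp: `6 ≤ trdeg ℚ(q,P,Q,R,q′,P′,Q′,R′)`, `q′ = e^{−2πi/τ}`) is GPC
  for `h¹(E_τ) ⊕ [ℤ² → 𝔾_m; (q, q′)]` (`dim G_mot = 6`: `q, q′` multiplicatively independent ⟺ `τ`
  non-quadratic) — STRONGER than the crux and equally unattackable; its only cheap boundary is the
  same CM collapse (`τ = i`: `q′ = q`, eight numbers become four, `trdeg = 3 < 6`), already covered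
  by §1. No stub of the line is refutable short of refuting GPC.
* `-- Targets`: none (payload `stuck_stubs = []`; the lead's `disprover-wanted` asks for a METHOD
  no-go — "linear cusp conditions at two multiplicatively independent nomes + finitely many
  algebraic relations ⇒ smallness exponent ≤ 4" (card cusp-budget-lemma L2 extended) — which is a
  barrier statement about auxiliary-function schemes, not a negation of any typed stub; it is
  outside this seat's anti-leakage remit (no Theses decl, no stub signature) and is recorded here
  as the open request it is).
* `-- Near-misses`: none needing `sorry`.

## WHY IT RESISTS (numbers, not adjectives)

(1) LOGICAL: crux ⟺ GPC(`M_τ`) for every non-CM `τ ∈ ℍ` (§0), `dim G_mot = 5` with no slack; a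
witness needs a non-quadratic `τ` carrying TWO independent algebraic relations among
`(2πi, τ, q, P, Q, R)`. One relation defines a countable subset of `ℍ` (Mahler: `τ, q, P, Q, R` are
algebraically independent FUNCTIONS, and `π ∉ ℚ̄`, so no relation holds identically); two
independent relations meet only by coincidence, and every PROVABLE coincidence class is excluded
by a theorem: (`τ`, `q` both algebraic) Gelfond–Schneider; (`τ`, `j`) Schneider 1937 ⇒ CM;
(`q`, `j`) Barré-Sirieix–Diaz–Gramain–Philibert 1996; (`q` algebraic, any relation among `P,Q,R`)
Nesterenko 1996; (CM) excluded by hypothesis. Unexcluded classes with NO known instance: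
`τ ∈ ℚ̄(π)` with `j(τ) ∈ ℚ̄` (is `j(iπ)` algebraic? open), `τ ∈ ℚ̄` of degree ≥ 3 with `E₂(τ)/π`-type
relations, `π` algebraic over `ℚ(log α)`.
(2) CONSEQUENCES a proof must deliver (so provers cannot close it either): `e ⊥ π` (`τ = i/2π`),
`π ⊥ log α` for every algebraic `0 < |α| < 1` (`τ_α`), GPC for non-CM elliptic curves over `ℚ̄`
(`j(τ) ∈ ℚ̄`), `π ⊥ e^{2πiτ}` for algebraic `τ` of degree ≥ 3. Known: `3` of the `5` at every `τ`
(Nesterenko, tree theorem); nothing beyond `3` at any non-CM point.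
(3) NUMERICS (earlier seats, attached to the item): PSLQ found NO integer relation — j022965/j025311
(`(π, e, P, Q, R)(1/e)` deg ≤ 3 norm < 1e12; `(π, log 2, P, Q, R)(1/2)`, `τ₀`, the `E₂`-zero `iy₀`
deg ≤ 2 norm < 1e15), j024231 (deg ≤ 2, 900 digits, |c| ≤ 1e10), j025152 (86 points
`τ ∈ {0,½} + i(a/b)π^{±1,±2}`: `j(τ)` not algebraic of degree ≤ 4, height ≤ 1e7; 169 cubic/quartic `τ`:
`E₂²/E₄, E₂E₄/E₆, E₂E₆/E₄²` not algebraic of degree ≤ 4, height ≤ 1e6; PSLQ deg ≤ 2 on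
`(π, q_τ, q_σ, P, Q, R)` at four cubic `τ`). THIS CYCLE, one new degeneracy CLASS (job j025976,
`e2star_scan.py`, auto-attached to the item): "CM-type relation at a NON-CM algebraic `τ`" — is one of
the weight-0 almost-holomorphic combinations `E₂*E₄/E₆`, `E₂*²/E₄`, `E₂*E₆/E₄²`
(`E₂* = E₂ − 3/(π Im τ)`; ALGEBRAIC at every CM point by Masser/Ramanujan, used as positive controls)
algebraic of degree ≤ 8, height ≤ 1e8 at `τ = iy`, `½ + iy` for ~30 real algebraic `y` of degree
2–4 with `y² ∉ ℚ`? Such a relation `F(π, Im τ, P, Q, R) = 0` over `ℚ̄` would be the SECOND relation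
(next to `τ ∈ ℚ̄`; `Im τ = (τ − τ̄)/2i ∈ ℚ̄`) and give `trdeg ≤ 4 < 5` — a counterexample to the crux
and to GPC. GPC predicts no hit; see the job output `e2star_scan.txt` for the table (a reported
'CANDIDATE-COUNTEREXAMPLE' line must be re-verified at higher precision before being believed).
(4) BARRIERS (catalogue `Literature/Barriers/Schanuel/`): `NesterenkoModularScope` (the only engine on
the Tate locus outputs `3 = #functions − 1`, blind to `τ` and `2πi`), `AlgebraicIndependenceOfLogarithms`
(fibre `q ∈ ℚ̄` contains two algebraically independent logarithms — "not even known to exist"),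
`PeriodConjectureOverQbarScope` (Huber–Wüstholz gives ℚ̄-LINEAR relations of 1-periods over ℚ̄ only;
`M_τ` lives over a transcendental base), `AxSchanuelFunctionalNotNumerical` (the functional analogue —
Mahler + Ax — is TRUE and says nothing about values). None of them is an impossibility theorem for the
statement; all of them are impossibility-of-method markers. Negatives index (`ledger negatives
--problem Schanuel`): PolarPhantoms R1/R2 only — unrelated.

VERDICT (cycle 1): no kill; the crux is conjecture-grade TRUE-by-consensus (GPC) and open; the
negative side's deliverable is the load-bearing/tightness census above. A disprover re-arm is only
worth it if a line registers stubs WEAKER than GPC (e.g. a multiplicity estimate or a cusp-budget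
lemma with explicit constants) — those are attackable by small models; `TwoNomeS` is not.
-/

noncomputable section

set_option linter.dupNamespace false

namespace Summit.Schanuel.Schanuel.Cruxes.TateLocusGPCOne.Disproof

open Complex IntermediateField
open Summit.Schanuel.Schanuel.Theorems.TateLocusGPCOne.Negative

/-- The six generators of the crux at `τ`, route spelling. -/
local notation "SIX(" τ ")" =>
  ({2 * (Real.pi : ℂ) * Complex.I, τ, Complex.exp (2 * Real.pi * Complex.I * τ),
    1 - 24 * ∑' l : ℕ, (ArithmeticFunction.sigma 1 (l + 1) : ℂ) *
      Complex.exp (2 * Real.pi * Complex.I * τ) ^ (l + 1),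
    1 + 240 * ∑' l : ℕ, (ArithmeticFunction.sigma 3 (l + 1) : ℂ) *
      Complex.exp (2 * Real.pi * Complex.I * τ) ^ (l + 1),
    1 - 504 * ∑' l : ℕ, (ArithmeticFunction.sigma 5 (l + 1) : ℂ) *
      Complex.exp (2 * Real.pi * Complex.I * τ) ^ (l + 1)} : Set ℂ)

/-- "`τ` is not a root of a monic rational quadratic" (the non-CM clause of the crux). -/
def NonQuadratic (τ : ℂ) : Prop := ∀ b c : ℚ, τ ^ 2 + (b : ℂ) * τ + (c : ℂ) ≠ 0

/-- The crux, by name, is the `5 ≤ trdeg ℚ(SIX(τ))` statement attacked below (`Iff.rfl`). -/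
theorem crux_iff : Summit.Schanuel.Schanuel.Theses.TateNomes.TateLocusGPCOne ↔
    ∀ τ : ℂ, 0 < τ.im → NonQuadratic τ → (5 : Cardinal) ≤ Algebra.trdeg ℚ ↥(adjoin ℚ SIX(τ)) :=
  Iff.rfl

/-! ## §1 Load-bearing hypotheses -/

/-- `TateLocusGPCOne` with the non-quadratic (non-CM) clause dropped. -/
def CruxWithoutNonQuadratic : Prop :=
  ∀ τ : ℂ, 0 < τ.im → (5 : Cardinal) ≤ Algebra.trdeg ℚ ↥(adjoin ℚ SIX(τ))

/-- **Any proof must use non-CM** (p143528; witness `τ = i`, `R = E₆(i) = 0`). -/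
theorem crux_false_without_nonQuadratic : ¬ CruxWithoutNonQuadratic :=
  tateLocusGPCOne_false_without_nonQuadratic

/-- **CM calibration, exact** (this cycle): `trdeg ℚ(2πi, i, e^{−2π}, P, Q, R) = 3` — upper bound
from `E₂(i) = 3/π`, `E₆(i) = 0`, lower bound Nesterenko's theorem (tree, sorry-free). -/
theorem crux_cm_calibration : Algebra.trdeg ℚ ↥(adjoin ℚ SIX(Complex.I)) = 3 :=
  tateLocusGPCOne_cm_calibration

/-- **Without non-CM even `4 ≤ trdeg` fails**: the CM exclusion is worth two degrees. -/
theorem not_crux_four_without_nonQuadratic :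
    ¬ (∀ τ : ℂ, 0 < τ.im → (4 : Cardinal) ≤ Algebra.trdeg ℚ ↥(adjoin ℚ SIX(τ))) :=
  not_tateLocusGPCOne_four_without_nonQuadratic

/-- `TateLocusGPCOne` with the convergence hypothesis `0 < Im τ` dropped. -/
def CruxWithoutImPos : Prop :=
  ∀ τ : ℂ, NonQuadratic τ → (5 : Cardinal) ≤ Algebra.trdeg ℚ ↥(adjoin ℚ SIX(τ))

/-- **Any proof must use `0 < Im τ`** (witness `τ₁ = −i·2^{1/4}`: divergent `q`-series, junk
`tsum = 0`, generators `2πi, τ₁, q, 1, 1, 1`, `trdeg ≤ 2`). -/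
theorem crux_false_without_imPos : ¬ CruxWithoutImPos :=
  tateLocusGPCOne_false_without_imPos

/-- **The generator `2πi` is load-bearing**: `5 ≤ trdeg ℚ(τ, q, P, Q, R)` is false at
`τ₀ = i·2^{1/4}` (`≤ 4`; the right conjecture there is Nesterenko's 1.11 with `4`). -/
theorem crux_false_without_gen_twoPiI :
    ¬ (∀ τ : ℂ, 0 < τ.im → NonQuadratic τ → (5 : Cardinal) ≤ Algebra.trdeg ℚ ↥(adjoin ℚ
        ({τ, Complex.exp (2 * Real.pi * Complex.I * τ),
          1 - 24 * ∑' l : ℕ, (ArithmeticFunction.sigma 1 (l + 1) : ℂ) *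
            Complex.exp (2 * Real.pi * Complex.I * τ) ^ (l + 1),
          1 + 240 * ∑' l : ℕ, (ArithmeticFunction.sigma 3 (l + 1) : ℂ) *
            Complex.exp (2 * Real.pi * Complex.I * τ) ^ (l + 1),
          1 - 504 * ∑' l : ℕ, (ArithmeticFunction.sigma 5 (l + 1) : ℂ) *
            Complex.exp (2 * Real.pi * Complex.I * τ) ^ (l + 1)} : Set ℂ))) :=
  tateLocusGPCOne_false_without_gen_twoPiI

/-- **The generator `τ` is load-bearing**: `5 ≤ trdeg ℚ(2πi, q, P, Q, R)` is false at the
algebraic nome `q = (3+4i)/10` (`≤ 4`). -/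
theorem crux_false_without_gen_tau :
    ¬ (∀ τ : ℂ, 0 < τ.im → NonQuadratic τ → (5 : Cardinal) ≤ Algebra.trdeg ℚ ↥(adjoin ℚ
        ({2 * (Real.pi : ℂ) * Complex.I, Complex.exp (2 * Real.pi * Complex.I * τ),
          1 - 24 * ∑' l : ℕ, (ArithmeticFunction.sigma 1 (l + 1) : ℂ) *
            Complex.exp (2 * Real.pi * Complex.I * τ) ^ (l + 1),
          1 + 240 * ∑' l : ℕ, (ArithmeticFunction.sigma 3 (l + 1) : ℂ) *
            Complex.exp (2 * Real.pi * Complex.I * τ) ^ (l + 1),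
          1 - 504 * ∑' l : ℕ, (ArithmeticFunction.sigma 5 (l + 1) : ℂ) *
            Complex.exp (2 * Real.pi * Complex.I * τ) ^ (l + 1)} : Set ℂ))) :=
  tateLocusGPCOne_false_without_gen_tau

/-- **The generator `q` is load-bearing** (`5 ≤ trdeg ℚ(2πi, τ, P, Q, R)` false at `τ₀`); the
companions `…_gen_P`, `…_gen_Q`, `…_gen_R` are in `TateLocusGPCOneGenerators.lean`. -/
theorem crux_false_without_gen_q :
    ¬ (∀ τ : ℂ, 0 < τ.im → NonQuadratic τ → (5 : Cardinal) ≤ Algebra.trdeg ℚ ↥(adjoin ℚ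
        ({2 * (Real.pi : ℂ) * Complex.I, τ,
          1 - 24 * ∑' l : ℕ, (ArithmeticFunction.sigma 1 (l + 1) : ℂ) *
            Complex.exp (2 * Real.pi * Complex.I * τ) ^ (l + 1),
          1 + 240 * ∑' l : ℕ, (ArithmeticFunction.sigma 3 (l + 1) : ℂ) *
            Complex.exp (2 * Real.pi * Complex.I * τ) ^ (l + 1),
          1 - 504 * ∑' l : ℕ, (ArithmeticFunction.sigma 5 (l + 1) : ℂ) *
            Complex.exp (2 * Real.pi * Complex.I * τ) ^ (l + 1)} : Set ℂ))) :=
  tateLocusGPCOne_false_without_gen_q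

/-! ## §2 Non-vacuity: certified points of the domain -/

/-- **Hypotheses satisfiable on the algebraic-`τ` fibre** (p143528: `τ₀ = i·2^{1/4}`). -/
theorem crux_hypotheses_satisfiable : ∃ τ : ℂ, 0 < τ.im ∧ NonQuadratic τ :=
  tateLocusGPCOne_hypotheses_satisfiable

/-- **Hypotheses satisfiable on the algebraic-NOME fibre** (`τ_α`, `e^{2πiτ_α} = (3+4i)/10`),
with no transcendence input (Gaussian-integer argument mod 5). -/
theorem crux_hypotheses_at_algebraic_nome :
    ∃ τ : ℂ, 0 < τ.im ∧ NonQuadratic τ ∧ IsAlgebraic ℚ (Complex.exp (2 * Real.pi * Complex.I * τ)) :=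
  tateLocusGPCOne_hypotheses_at_algebraic_nome

/-! ## §3 Tightness: the `5` cannot be raised, and is the exact prediction on two fibres -/

/-- **`6 ≤ trdeg` is false under the crux's hypotheses** (p143528, `τ₀`). -/
theorem not_crux_six :
    ¬ (∀ τ : ℂ, 0 < τ.im → NonQuadratic τ → (6 : Cardinal) ≤ Algebra.trdeg ℚ ↥(adjoin ℚ SIX(τ))) :=
  not_tateLocusGPCOne_six

/-- **`trdeg ≤ 5` at the algebraic nome** `τ_α = log((3+4i)/10)/2πi`. -/
theorem crux_trdeg_le_five_at_algebraic_nome :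
    Algebra.trdeg ℚ ↥(adjoin ℚ
      SIX((Complex.log ((3 + 4 * Complex.I) / 10) / (2 * (Real.pi : ℂ) * Complex.I)))) ≤
      (5 : Cardinal) :=
  trdeg_le_five_at_algebraic_nome

/-! ## §4 What the crux is equivalent to / implies (orientation for provers; proved elsewhere)

* `crux → NesterenkoConjecture_1_11_corrected` (grounder bridge, evidence GroundTateNomes.lean;
  strategist `nesterenkoTau_of_crux`), and `crux ↔ NesterenkoTau ∧ PiRigidity`
  (StrategistSketch.lean, both directions proved).
* `3 ≤ trdeg ℚ(q, P, Q, R)` at every `τ ∈ ℍ` is a THEOREM (below, from the tree), so exactly two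
  degrees — `τ`'s and `2πi`'s — are open at every non-CM point. -/

/-- **Nesterenko's `3` at every point of `ℍ`** (tree theorem `nesterenko1996_thm_1_1_holds`), in
the route's coordinates: the crux asks for exactly two more. -/
theorem three_le_trdeg_six (τ : ℂ) (hτ : 0 < τ.im) :
    (3 : Cardinal) ≤ Algebra.trdeg ℚ ↥(adjoin ℚ SIX(τ)) := by
  have h3 := Literature.Barriers.Schanuel.three_le_trdeg_adjoin_of_thm_1_1
    Literature.Barriers.Schanuel.nesterenko1996_thm_1_1_holds τ hτ
  have hle : adjoin ℚ ({cexp (2 * Real.pi * I * τ),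
      Literature.Barriers.Schanuel.ramanujanP (cexp (2 * Real.pi * I * τ)),
      Literature.Barriers.Schanuel.ramanujanQ (cexp (2 * Real.pi * I * τ)),
      Literature.Barriers.Schanuel.ramanujanR (cexp (2 * Real.pi * I * τ))} : Set ℂ) ≤
      adjoin ℚ SIX(τ) := by
    refine adjoin.mono ℚ _ _ ?_
    intro x hx
    simp only [Set.mem_insert_iff, Set.mem_singleton_iff] at hx
    rcases hx with rfl | rfl | rfl | rfl
    · exact Or.inr (Or.inr (Or.inl rfl))
    · exact Or.inr (Or.inr (Or.inr (Or.inl rfl)))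
    · exact Or.inr (Or.inr (Or.inr (Or.inr (Or.inl rfl))))
    · exact Or.inr (Or.inr (Or.inr (Or.inr (Or.inr rfl))))
  exact h3.trans (trdeg_le_of_injective (inclusion hle) (inclusion_injective hle))

-- Targets: none this cycle (payload `stuck_stubs = []`; line `Sketch`'s only stub `TwoNomeS` is
-- GPC of dimension 6, see the module docstring §4).

-- Near-misses: none.

end Summit.Schanuel.Schanuel.Cruxes.TateLocusGPCOne.Disproof

end
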